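import Summits.QuantumFields.QCD.Theses.WilsonQuarkChessboard
import Summits.QuantumFields.QCD.Theorems.QuarksAsStableActionCriticalLineDiamagnetismStubQuarkChessboardOfSchwarz

/-!
# QuantumFields / QCD — route `WilsonQuarkChessboard`, the assembly `Assembly` (stmt-QuantumFields-9311)

Route `QCD/WilsonQuarkChessboard` (chessboard domination of the Wilson quark determinant), item
stmt-QuantumFields-9311 (`Assembly`, rank 1):

  `QuarkChessboard → FlatCellOptimal → DominationBridge → QCD`.

`DominationBridge` is by definition the implication `QuarkChessboard → FlatCellOptimal → QCD`, so
the assembly is modus ponens: given `hC : QuarkChessboard`, `hK : FlatCellOptimal` and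
`hB : DominationBridge`, the term `hB hC hK : QCD` closes it.  This is literally the type (and the
proof term) of the route file's kernel-checked deciding theorem
`Summit.QuantumFields.QCD.Theses.WilsonQuarkChessboard.closes` (D-0027 §2.1), whose conclusion is
the sub-problem constant `_root_.QCD` (`= QCDOf 2 ∧ QCDOf 3`) of
`Summits/QuantumFields/QCD/Statement.lean`.  No analysis, no named facts; axioms ⊆
{propext, Classical.choice, Quot.sound}.

Design note: this module imports the Theses module (the statement is cited BY NAME, as the gate's
closing probe requires), so the gate records the closure as the docstring link in the route file
rather than as an in-file `Assembly_holds` theorem (a re-import would be an import cycle).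

**Repair 2026-08-16.** `wilsonQuarkChessboard_assembly_proof` proved the rev-≤6 assembly
`QuarkChessboard → FlatCellOptimal → DominationBridge → QCD` (item stmt-QuantumFields-9311, closed
`proved` by it). The route repair of 2026-08-16T19:39Z restated the item UNDER THE SAME DECL NAME
`Assembly` as the SHARP closing path `BackgroundSchwarz → FlatCellOptimal → DominationBridge → QCD`
(item stmt-QuantumFields-16585), so the old proof script (`intro hC hK hB; exact hB hC hK`) stopped
elaborating against the new definiens (fullbuild breakage "40:11: Application type mismatch"). The
theorem keeps its name and statement text (Theorems files are append-only) and now proves the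
current `Assembly` by the planner's recorded one-liner: the background Schwarz inequality `hS` gives
the quark chessboard through the landed Fröhlich–Israel–Lieb–Simon iteration
`Cruxes.CriticalLineDiamagnetism.ChessboardCellGain.stub_quarkChessboard_of_schwarz` (p112660,
`Theorems/QuarksAsStableActionCriticalLineDiamagnetismStubQuarkChessboardOfSchwarz.lean`, now
imported), and the bridge `hB : QuarkChessboard → FlatCellOptimal → QCD` applied to it and `hK`
is the goal. Still pure logic over landed declarations; this module imports the route module, so
the closure is recorded as the docstring link, not as an in-file `Assembly_holds` (see above).

References: A. Jaffe, E. Witten, *Quantum Yang–Mills theory* (Clay problem description, 2000);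
J. Fröhlich, R. Israel, E. H. Lieb, B. Simon, *Phase transitions and reflection positivity. I*,
Comm. Math. Phys. 62 (1978) 1–34.
-/

namespace Summit.QuantumFields.QCD.Theorems

/-- **Assembly of route `WilsonQuarkChessboard`** (since the 2026-08-16 restate under the same
decl name: item stmt-QuantumFields-16585, `BackgroundSchwarz → FlatCellOptimal → DominationBridge →
QCD`; originally item stmt-QuantumFields-9311, `QuarkChessboard → FlatCellOptimal → DominationBridge
→ QCD` — see the module docstring).  Pure logic over landed declarations: `DominationBridge` unfolds
to `QuarkChessboard → FlatCellOptimal → QCD`, and the background Schwarz inequality yields the quark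
chessboard by the landed FILS iteration `ChessboardCellGain.stub_quarkChessboard_of_schwarz`, so the
bridge applied to that and to the flat-cell optimum is the goal (the planner's `assemblyR_holds`).
[folklore] -/
theorem wilsonQuarkChessboard_assembly_proof :
    Summit.QuantumFields.QCD.Theses.WilsonQuarkChessboard.Assembly := by
  unfold Summit.QuantumFields.QCD.Theses.WilsonQuarkChessboard.Assembly
  -- rev ≥ 7: `Assembly` is `BackgroundSchwarz → FlatCellOptimal → DominationBridge → QCD`
  intro hS hK hB
  exact hB
    (Summit.QuantumFields.QCD.Cruxes.CriticalLineDiamagnetism.ChessboardCellGain.stub_quarkChessboard_of_schwarz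
      hS) hK

end Summit.QuantumFields.QCD.Theorems
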